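/-
# Decaying local-inverse and commutator letters FROM coercivity; Theorem 3.10 at one scale (print's bookkeeping) with
# the local inverses CONSTRUCTED — the decay-kept twin of file 36's END

Cell `pub-balaban-gaps`, seat **g1-p2 GEN 5** (prover), row **(D4)**.  Junction J46-2 of planner g1-plan-1 GEN 16
([G1-PLAN1-G16-XREAD-G1P2-I46], INBOX l.1914: «DECAYING LOCAL-INVERSE LETTER FROM COERCIVITY … the decay-kept twin of 36's
END»); statement shapes CONVERGENT with plan-1's independently typed NOT-TO-FILE skeleton #15
(`pub-balaban-gaps-g1-plan-1/skel15_F_decay_letter_from_coercivity.NOT-TO-FILE.lean`, sha16 d27c66a7cf2ae3a8, farm rc 0,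
[G1-PLAN1-G16-POINTER-SKEL15] INBOX l.1926: `blockNorm_le_exp_of_entry_decay`, `blockNorm_locInv_le_exp`, `hLbdD_of_coercive`,
`hKbdD_of_range_ball`); typing and proofs below are this seat's.  File 36 (`D4WalkBlockLocalInverse`) CONSTRUCTS the local
inverses `G′_□(u) := extend((compress (1 + K′(u)) (Es □))⁻¹)` and proves the ENTRYWISE Combes–Thomas bound
`‖G′_□(u)(i,j)‖ ≤ m⁻¹e^{−κ_c ds(i,j)}` from UNIFORM conjugated coercivity (`norm_locInv_apply_le`), but its block letter
`blockNorm_locInv_le` is FLAT (`c_s∕m`) — whence the loss `e^{2ρ₀r}` in 36's END margin, the very loss files 43–45 remove by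
keeping decay.  Here:
* §1 `blockNorm_le_of_entry_decay`: an entrywise bound `a·e^{−κ ds(i,j)}`, a cube∕site comparison `ρ₀·d₁(cubn i, cubn j) ≤
  κ′·ds(i,j)` and the site row sum `Σ_j e^{−(κ−κ′)ds(i,j)} ≤ c_s′` give the DECAYING block letter `a·c_s′·e^{−ρ₀d₁(y,y′)}`
  (split `e^{−κ ds} = e^{−κ′ds}·e^{−(κ−κ′)ds}`: one factor is the cube decay, the other is summed);
* §2 the decaying letters of 45's `blockWalkExpansion_print_parametrix` for the CONSTRUCTED objects: `hLbdD` with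
  `C_L = c_s′∕m` at rate `ρ₀` for `G′_□(u)` (§1 + 36), `hKbdD` with `λ_K = (r₁∕M)C_K·e^{κ′r₁}` at rate `ρ₀` for `K(h_□)(u)`
  (35's `blockNorm_comm_le` + range `r₁` of `K′` + the comparison);
* §3 THE END `blockWalkExpansion_accretive_print` = 45 ∘ §2 BY NAME: from letters on `Δ′(u) = 1 + K′(u)` ALONE (uniform
  conjugated coercivity, range, block bound, holomorphy), a `1∕M`-Lipschitz partition and print's decoration data, the
  s-decorated glued family of the constructed local inverses is a `BlockWalkExpansion` with margin
  `q = c_μ⁵·n_C·(r₁∕M)C_Ke^{κ′r₁}·(c_s′∕m)·e^{μr}·n_D` — NO `e^{2ρ₀r}`, NO `e^{κ₁m_J}` —; and at `s ≡ 1` its kernel is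
  `(1 + K′(u))⁻¹` given `Σ_□h_□² = 1` and `1 − R(u)` invertible (36's `locInv_letters` discharge the two algebraic letters).
HONEST FRAMING (wording after plan-1's J47-1, INBOX l.1935): packaging at MODEL generality; `hcoer` delivers the decaying
letters k-uniformly INSIDE THE MODEL CLASS (O(1) sites per cube, finite-range `K′`); for Bałaban's `Δ^{(k)}(𝐔)` ∕ `G_k(Ω,𝐔)` the
operator letter left is the k-uniform DECAYING kernel bound [B9] (3.42)∕(3.48) (cell gap G-B9-10) — fed either directly into
45's `hLbdD` or, at unit-lattice packaging, into `hcoer` + a decaying-range twin of `hKrange` —; `hcoer` ALONE is not that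
letter at fine resolution (entry → block currency loses `η^{−d}`); (D4) instance 0∕1; NOT continuum, NOT Clay.

References: T. Bałaban, Comm. Math. Phys. 99 (1985) 389–434 [B9], Thm 3.1 (3.42) p.397, p.399, Cor 3.6 p.408, Thm 3.7
(3.87)–(3.90) p.409, Cor 3.8 p.410, Thm 3.10 p.416; Comm. Math. Phys. 116 (1988) 1–22 [II], p.3, (1.11) p.5, p.13, p.15.
-/
import Summits.QuantumFields.BalabanUV.Gaps.D4WalkBlockParametrixDecay
import Summits.QuantumFields.BalabanUV.Gaps.D4WalkBlockLocalInverse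

noncomputable section

namespace Summit.QuantumFields.BalabanUV.Gaps.D4WalkBlockAccretiveDecay

open Metric Set Finset
open Literature.MathematicalPhysics.QuantumFieldTheory.Balaban1983to89
open Literature.MathematicalPhysics.QuantumFieldTheory.Balaban1983to89.B9SectDWalk (DomBy)
open Literature.MathematicalPhysics.QuantumFieldTheory.Balaban1983to89.B9Thm34Ext (toB6)
open Literature.MathematicalPhysics.QuantumFieldTheory.Balaban1983to89.B9Thm37GlueTorus (torusGeom tdist1 tdist1_nonneg)
open Literature.MathematicalPhysics.QuantumFieldTheory.Balaban1983to89.TreeLengthTorus (TPt)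
open Literature.MathematicalPhysics.QuantumFieldTheory.Balaban1983to89.B5TorusCover (UT)
open Literature.MathematicalPhysics.QuantumFieldTheory.Balaban1983to89.B11SectG (RowSum)
open Literature.MathematicalPhysics.QuantumFieldTheory.Balaban1983to89.B5Prop11Lower (nsq)
open Literature.MathematicalPhysics.QuantumFieldTheory.Balaban1983to89.B13DomainKernelWalks (DomainTerms)
open Summit.QuantumFields.BalabanUV.Gaps.D4WalkBlock
  (rowMass blockNorm blockNorm_nonneg rowMass_le_blockNorm blockNorm_le_of_rowMass_le BlockWalkExpansion)
open Summit.QuantumFields.BalabanUV.Gaps.D4WalkBlockCommutator (exists_entry_of_blockNorm_ne_zero blockNorm_comm_le)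
open Summit.QuantumFields.BalabanUV.Gaps.D4WalkBlockLocalInverse
  (norm_locInv_apply_le differentiableOn_locInv locInv_letters isUnit_compress)
open Summit.QuantumFields.BalabanUV.Gaps.D4WalkBlockDecorate (decTerm decKernel)
open Summit.QuantumFields.BalabanUV.Gaps.D4WalkBlockParametrixDecay (blockWalkExpansion_print_parametrix decKernel_one_eq_inv)
open Summit.QuantumFields.BalabanUV.T4Continuum.Spine.NE5.TwoRunPencilDomains (withOp)
open Summit.QuantumFields.BalabanUV.Beta.UnitLatticeWalkInversion (Hd Pj comm_apply)
open Summit.QuantumFields.BalabanUV.Beta.UnitLatticeLocalInverse (compress extend)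
open Summit.QuantumFields.BalabanUV.Beta.AccretiveCombesThomas (conjForm)

variable {ν : ℕ} {K : Fin ν → ℕ} [∀ i, NeZero (K i)]
variable {n : Type} [Fintype n] [DecidableEq n] {B : Type}

/-! ## §1. A decaying block letter from an entrywise decay bound -/

omit [DecidableEq n] in
/-- **DECAYING BLOCK LETTER FROM ENTRYWISE DECAY**: if `‖T(i,j)‖ ≤ a·e^{−κ·ds(i,j)}`, the cube distance is dominated along
sites, `ρ₀·d₁(cubn i, cubn j) ≤ κ′·ds(i,j)`, and the residual site row sum is `Σ_j e^{−(κ−κ′)ds(i,j)} ≤ c_s′`, then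
`‖T‖_{y,y′} ≤ a·c_s′·e^{−ρ₀d₁(y,y′)}` — (3.42) summed over a cube WITH ITS DECAY KEPT. [cite: Balaban1985BackgroundPropagators, Thm 3.1 (3.42) p.397, Cor 3.6 p.408, (3.89) p.409] -/
theorem blockNorm_le_of_entry_decay (cubn : n → UT K) (T : Matrix n n ℂ) (ds : n → n → ℝ) {a κ κ' ρ₀ cs' : ℝ}
    (ha : 0 ≤ a) (hcs' : 0 ≤ cs') (hT : ∀ i j, ‖T i j‖ ≤ a * Real.exp (-(κ * ds i j)))
    (hcmp : ∀ i j, ρ₀ * tdist1 K (cubn i) (cubn j) ≤ κ' * ds i j)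
    (hsite' : ∀ i, ∑ j, Real.exp (-((κ - κ') * ds i j)) ≤ cs') (y y' : UT K) :
    blockNorm cubn cubn T y y' ≤ a * cs' * Real.exp (-(ρ₀ * tdist1 K y y')) := by
  refine blockNorm_le_of_rowMass_le cubn cubn T y y' (by positivity) fun i hi => ?_
  have hsplit : ∀ j, a * Real.exp (-(κ * ds i j)) =
      a * (Real.exp (-(κ' * ds i j)) * Real.exp (-((κ - κ') * ds i j))) := fun j => by
    rw [← Real.exp_add]; congr 1; congr 1; ring
  have hcube : ∀ j ∈ Finset.univ.filter (fun j => cubn j = y'),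
      ‖T i j‖ ≤ a * Real.exp (-(ρ₀ * tdist1 K y y')) * Real.exp (-((κ - κ') * ds i j)) := by
    intro j hj
    have hj' : cubn j = y' := (Finset.mem_filter.1 hj).2
    refine (hT i j).trans ?_
    rw [hsplit j, ← mul_assoc]
    refine mul_le_mul_of_nonneg_right (mul_le_mul_of_nonneg_left (Real.exp_le_exp.2 ?_) ha) (Real.exp_pos _).le
    have := hcmp i j
    rw [hi, hj'] at this
    linarith
  calc rowMass cubn T i y' ≤ ∑ j ∈ Finset.univ.filter (fun j => cubn j = y'),
        a * Real.exp (-(ρ₀ * tdist1 K y y')) * Real.exp (-((κ - κ') * ds i j)) := Finset.sum_le_sum hcube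
    _ ≤ ∑ j, a * Real.exp (-(ρ₀ * tdist1 K y y')) * Real.exp (-((κ - κ') * ds i j)) :=
        Finset.sum_le_sum_of_subset_of_nonneg (Finset.filter_subset _ _) fun j _ _ => by positivity
    _ = a * Real.exp (-(ρ₀ * tdist1 K y y')) * ∑ j, Real.exp (-((κ - κ') * ds i j)) := by rw [Finset.mul_sum]
    _ ≤ a * Real.exp (-(ρ₀ * tdist1 K y y')) * cs' := mul_le_mul_of_nonneg_left (hsite' i) (by positivity)
    _ = a * cs' * Real.exp (-(ρ₀ * tdist1 K y y')) := by ring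

/-! ## §2. The decaying letters of the CONSTRUCTED local inverses and commutators -/

/-- **DECAYING LOCAL-INVERSE LETTER FROM COERCIVITY**: for `A` conjugated-coercive `m > 0` at rate `κ ≥ 0` along every column
weight `ds(·,j)`, with the cube∕site comparison at `κ′` and the residual site row sum `c_s′`:
`‖extend((compress A S)⁻¹)‖_{y,y′} ≤ (c_s′∕m)·e^{−ρ₀d₁(y,y′)}` — file 36's flat `c_s∕m` letter with (3.42)'s decay kept.
[cite: Balaban1985BackgroundPropagators, Thm 3.1 (3.42) p.397, Cor 3.6 p.408] -/
theorem blockNorm_locInv_le_decay (cubn : n → UT K) (A : Matrix n n ℂ) (S : Finset n) (ds : n → n → ℝ)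
    (hd0 : ∀ j, ds j j = 0) {κ κ' ρ₀ m cs' : ℝ} (hκ : 0 ≤ κ) (hm : 0 < m)
    (hc : ∀ j, ∀ z : n → ℂ, m * nsq z ≤ (conjForm A κ (fun e => ds e j) z).re)
    (hcmp : ∀ i j, ρ₀ * tdist1 K (cubn i) (cubn j) ≤ κ' * ds i j)
    (hcs' : 0 ≤ cs') (hsite' : ∀ i, ∑ j, Real.exp (-((κ - κ') * ds i j)) ≤ cs') (y y' : UT K) :
    blockNorm cubn cubn (extend (compress A S)⁻¹) y y' ≤ cs' / m * Real.exp (-(ρ₀ * tdist1 K y y')) := by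
  have h := blockNorm_le_of_entry_decay cubn (extend (compress A S)⁻¹) ds (inv_nonneg.2 hm.le) hcs'
    (norm_locInv_apply_le A S ds hd0 hκ hm hc) hcmp hsite' y y'
  calc _ ≤ _ := h
    _ = cs' / m * Real.exp (-(ρ₀ * tdist1 K y y')) := by rw [div_eq_inv_mul]

/-- **DECAYING COMMUTATOR LETTER FROM RANGE**: for a `1∕M`-Lipschitz `h_□` and a range-`r₁` kernel `K′` with block bound `C_K`,
and the cube∕site comparison at `κ′ ≥ 0`: a non-zero block `(y,y″)` of `h_□K′ − K′h_□` has an entry `K′(i,j) ≠ 0` with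
`cubn i = y`, `cubn j = y″`, so `ρ₀d₁(y,y″) ≤ κ′r₁`; hence `‖h_□K′ − K′h_□‖_{y,y″} ≤ (r₁∕M)C_K·e^{κ′r₁}·e^{−ρ₀d₁(y,y″)}`.
[cite: Balaban1985BackgroundPropagators, (3.88)–(3.89) p.409, p.414] -/
theorem blockNorm_comm_le_decay (cubn : n → UT K) (h : B → n → ℝ) (ds : n → n → ℝ) {M r₁ CK κ' ρ₀ : ℝ} (hM : 0 < M)
    (hr₁ : 0 ≤ r₁) (hLip : ∀ b i j, |h b i - h b j| ≤ ds i j / M) (K' : Matrix n n ℂ)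
    (hKrange : ∀ i j, K' i j ≠ 0 → ds i j ≤ r₁) (hKbd : ∀ y y', blockNorm cubn cubn K' y y' ≤ CK) (hCK : 0 ≤ CK)
    (hκ' : 0 ≤ κ') (hcmp : ∀ i j, ρ₀ * tdist1 K (cubn i) (cubn j) ≤ κ' * ds i j) (b : B) (y y' : UT K) :
    blockNorm cubn cubn (Hd h b * K' - K' * Hd h b) y y' ≤
      r₁ / M * CK * Real.exp (κ' * r₁) * Real.exp (-(ρ₀ * tdist1 K y y')) := by
  by_cases h0 : blockNorm cubn cubn (Hd h b * K' - K' * Hd h b) y y' = 0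
  · rw [h0]; positivity
  obtain ⟨i, j, hi, hj, hij⟩ := exists_entry_of_blockNorm_ne_zero cubn cubn _ h0
  rw [comm_apply] at hij
  have hK : K' i j ≠ 0 := fun e => hij (by rw [e, mul_zero])
  have hd : ρ₀ * tdist1 K y y' ≤ κ' * r₁ := by
    have h1 := hcmp i j
    rw [hi, hj] at h1
    exact h1.trans (mul_le_mul_of_nonneg_left (hKrange i j hK) hκ')
  have hone : 1 ≤ Real.exp (κ' * r₁) * Real.exp (-(ρ₀ * tdist1 K y y')) := by
    rw [← Real.exp_add]
    exact Real.one_le_exp (by linarith)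
  calc blockNorm cubn cubn (Hd h b * K' - K' * Hd h b) y y' ≤ r₁ / M * blockNorm cubn cubn K' y y' :=
        blockNorm_comm_le cubn h ds hM hr₁ hLip K' hKrange b y y'
    _ ≤ r₁ / M * CK := mul_le_mul_of_nonneg_left (hKbd y y') (div_nonneg hr₁ hM.le)
    _ = r₁ / M * CK * 1 := (mul_one _).symm
    _ ≤ r₁ / M * CK * (Real.exp (κ' * r₁) * Real.exp (-(ρ₀ * tdist1 K y y'))) :=
        mul_le_mul_of_nonneg_left hone (mul_nonneg (div_nonneg hr₁ hM.le) hCK)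
    _ = _ := by ring

/-! ## §3. THE END: Theorem 3.10 at one scale, print's bookkeeping, local inverses CONSTRUCTED, decay kept -/

section End

variable {d N' : ℕ}
variable {E : Type*} [NormedAddCommGroup E] [NormedSpace ℂ E]
variable {L₀ : DomainTerms d N' ν K n n E} {h : L₀.B → n → ℝ} {Es : L₀.B → Finset n} {K' : E → Matrix n n ℂ}
variable {ds : n → n → ℝ}
variable {c₀ c : B13.Consts} {cubn : n → UT K} {X : Finset (UT K)} {R CK M m κc κ' cs' r₁ r : ℝ} {nD nC : ℕ}
variable {ρ₀ ε₀ κ₀ μ cμ : ℝ}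

/-- **THEOREM 3.10 AT ONE SCALE IN PRINT'S BOOKKEEPING, FROM LETTERS ON `Δ′(u) = 1 + K′(u)` ALONE, DECAY KEPT.**  A domain
skeleton `L₀` with untagged terms (`J ≡ ∅`; geometry `r ≥ 0`, `n_D`, `#dom □ ≤ n_C`), a partition `{h_□}` (`|h| ≤ 1`,
`1∕M`-Lipschitz in the symmetric site pseudo-distance `ds` with `ds(j,j) = 0`, supports `Es □` whose `r₁`-neighbourhood cubes lie in
`dom □`), `K′` entrywise holomorphic on the `R`-ball with range `r₁`, block bound `C_K`, `1 + K′(u)` CONJUGATED-COERCIVE `m > 0`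
at rate `κ_c ≥ 0` along every column weight UNIFORMLY on the ball, the cube∕site comparison `ρ₀d₁(cubn i, cubn j) ≤ κ′ds(i,j)`
(`κ′ ≥ 0`), the residual site row sum `Σ_j e^{−(κ_c−κ′)ds(i,j)} ≤ c_s′`, the cube row sum `(μ, c_μ)`, rates `0 ≤ μ`, `3μ ≤ ε₀`,
`2μ ≤ κ₀`, `κ₀ + μ ≤ ρ₀ − ε₀`, print's decoration data, and the MARGIN
`q = c_μ(c_μ·1·(1·((n_C·((r₁∕M)C_Ke^{κ′r₁})·(c_s′∕m))e^{κ₁·0})e^{μr}n_Dc_μ)c_μ)c_μ < 1` — "M sufficiently large" literal, NO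
`e^{2ρ₀r}` — ⟹ with `G′_□(u) := extend((compress (1 + K′(u)) (Es □))⁻¹)` the s-decorated glued family is a `BlockWalkExpansion`
at `(ε₀ − 3μ − κ₁P∕r₀, κ₀ − 2μ)`, whose `s ≡ 1` kernel is `S(u)·(1 − R(u))⁻¹`.  Composition BY NAME: §2 ×2 + 36 → 45.
[cite: Balaban1988RG2Cluster, p.3, (1.11) p.5, p.13, p.15; Balaban1985BackgroundPropagators, Thms 3.1–3.3 (3.42) p.397, p.399, Cor 3.6 p.408, Thm 3.7 (3.87)–(3.90) p.409, Cor 3.8 p.410, Thm 3.10 (3.107)–(3.108) p.416] -/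
theorem blockWalkExpansion_accretive_print
    (hanchor : ∀ b, L₀.anchor b ∈ L₀.dom b) (hdiam : ∀ b, ∀ z ∈ L₀.dom b, ∀ z' ∈ L₀.dom b, tdist1 K z z' ≤ r)
    (hJ0 : ∀ b, L₀.J b = ∅) (hmult : ∀ z : UT K, (Finset.univ.filter fun b => L₀.anchor b = z).card ≤ nD)
    (hsupp : ∀ b y, y ∉ Es b → h b y = 0) (habs : ∀ b y, |h b y| ≤ 1) (hE : ∀ b y, y ∈ Es b → cubn y ∈ L₀.dom b)
    (hKan : ∀ i j, DifferentiableOn ℂ (fun u => K' u i j) (ball (0 : E) R))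
    (hKbd : ∀ u ∈ ball (0 : E) R, ∀ y y', blockNorm cubn cubn (K' u) y y' ≤ CK) (hCK : 0 ≤ CK)
    (hM : 0 < M) (hr₁ : 0 ≤ r₁) (hsymm : ∀ i j, ds i j = ds j i) (hd0 : ∀ j, ds j j = 0)
    (hLip : ∀ b i j, |h b i - h b j| ≤ ds i j / M) (hKrange : ∀ u i j, K' u i j ≠ 0 → ds i j ≤ r₁)
    (hdomE : ∀ b i, (∃ k ∈ Es b, ds i k ≤ r₁) → cubn i ∈ L₀.dom b)
    (hcard : ∀ b, (L₀.dom b).card ≤ nC)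
    (hm : 0 < m) (hκc : 0 ≤ κc)
    (hcoer : ∀ u ∈ ball (0 : E) R, ∀ j, ∀ z : n → ℂ, m * nsq z ≤ (conjForm (1 + K' u) κc (fun e => ds e j) z).re)
    (hκ' : 0 ≤ κ') (hcmp : ∀ i j, ρ₀ * tdist1 K (cubn i) (cubn j) ≤ κ' * ds i j)
    (hcs' : 0 ≤ cs') (hsite' : ∀ i, ∑ j, Real.exp (-((κc - κ') * ds i j)) ≤ cs')
    (hκ₁₀ : 0 ≤ c₀.κ₁) (hr : 0 ≤ r) (hμ : 0 ≤ μ) (hμε : 3 * μ ≤ ε₀) (hμκ : 2 * μ ≤ κ₀) (hwin : κ₀ + μ ≤ ρ₀ - ε₀)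
    (hcμ : 0 ≤ cμ) (hrow : RowSum (toB6 (torusGeom K 0 0 0) 0 True) μ cμ)
    (hq : cμ * (cμ * 1 * (1 * (((nC * (r₁ / M * CK * Real.exp (κ' * r₁)) * (cs' / m)) * Real.exp (c₀.κ₁ * (0 : ℕ))) *
      Real.exp (μ * r) * (nD * cμ))) * cμ) * cμ < 1)
    (cellOf : UT K → TPt d N') (J' : L₀.B → Finset (TPt d N')) (hJ' : ∀ b, J' b ⊆ (L₀.dom b).image cellOf)
    (hJ'X : ∀ b, (J' b).Nonempty → (L₀.dom b ∩ X).Nonempty) {P : ℕ} {r₀ Rb : ℝ} (hr₀ : 0 < r₀) (hRD : r₀ + r ≤ Rb)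
    (hpack : ∀ a : UT K, ∃ S : Finset (TPt d N'), S.card ≤ P ∧ ∀ z, tdist1 K a z ≤ Rb → cellOf z ∈ S)
    (hκ₁ : 0 ≤ c.κ₁) (hshift : c.κ₁ * (P / r₀) ≤ ε₀ - 3 * μ) :
    ∃ (W : Type) (T : W → (TPt d N' → ℂ) → E → Matrix n n ℂ) (A : W → ℝ) (D : W → UT K → UT K → ℝ) (ρ' : ℝ)
      (dec : W → Finset (TPt d N')),
      BlockWalkExpansion c cubn cubn (decKernel T dec) X R (ε₀ - 3 * μ - c.κ₁ * (P / r₀)) (κ₀ - 2 * μ)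
        (Real.exp (c.κ₁ * P) * (Real.exp ((ε₀ - 3 * μ) * (2 * r)) *
          (cμ * (((cs' / m) * Real.exp (c₀.κ₁ * (0 : ℕ))) * Real.exp (μ * r) * (nD * cμ)) *
            (1 * (1 - cμ * (cμ * 1 * (1 * (((nC * (r₁ / M * CK * Real.exp (κ' * r₁)) * (cs' / m)) *
              Real.exp (c₀.κ₁ * (0 : ℕ))) * Real.exp (μ * r) * (nD * cμ))) * cμ) * cμ)⁻¹) * cμ)))
        (decTerm T dec) {w | (dec w).Nonempty} A D ρ' ∧
      (∀ u ∈ ball (0 : E) R, decKernel T dec (fun _ => 1) u =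
        (withOp L₀ fun b u => Hd h b * extend (compress (1 + K' u) (Es b))⁻¹ * Hd h b).kernel (fun _ => 1) u *
          ((1 : Matrix n n ℂ) + (-1 : ℂ) •
            (withOp L₀ fun b u =>
              (Hd h b * K' u - K' u * Hd h b) * extend (compress (1 + K' u) (Es b))⁻¹ * Hd h b).kernel (fun _ => 1) u)⁻¹) ∧
      ∀ ω, DomBy (toB6 (torusGeom K 0 0 0) 0 True) (D ω) :=
  blockWalkExpansion_print_parametrix (L := withOp L₀ fun b u => extend (compress (1 + K' u) (Es b))⁻¹)
    hanchor hdiam hJ0 hmult hsupp habs hE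
    (fun b i j => differentiableOn_locInv (Es b) ds hm
      (fun k l => by
        simp only [Matrix.add_apply]
        exact (differentiableOn_const _).add (hKan k l)) hcoer i j)
    (fun b u hu y y' => blockNorm_locInv_le_decay cubn (1 + K' u) (Es b) ds hd0 hκc hm (hcoer u hu) hcmp hcs' hsite' y y')
    (div_nonneg hcs' hm.le) hKan
    (fun b u hu y y'' => blockNorm_comm_le_decay cubn h ds hM hr₁ hLip (K' u) (hKrange u) (hKbd u hu) hCK hκ' hcmp b y y'')
    (by positivity)
    (fun b u y y' hne => D4WalkBlockCommutator.comm_blocks_subset cubn h Es hsupp ds hsymm (fun i => by rw [hd0]; exact hr₁)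
      (K' u) (hKrange u) L₀.dom hdomE b y y' hne)
    hcard hκ₁₀ hr hμ hμε hμκ hwin hcμ hrow hq cellOf J' hJ' hJ'X hr₀ hRD hpack hκ₁ hshift

/-- **… AND AT `s ≡ 1` THE DECORATED KERNEL IS `(1 + K′(u))⁻¹`** for the constructed local inverses: the two algebraic letters of
(3.88) hold for them (36's `locInv_letters`), so with `Σ_□h_□² = 1` and `1 − R(u)` invertible on the ball the `s ≡ 1` kernel of
§3's expansion is `Δ′(u)⁻¹` (45's `decKernel_one_eq_inv`). [cite: Balaban1985BackgroundPropagators, (3.88)–(3.90) p.409; Balaban1988RG2Cluster, p.3] -/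
theorem accretive_print_one_eq_inv {W : Type} {T : W → (TPt d N' → ℂ) → E → Matrix n n ℂ} {dec : W → Finset (TPt d N')}
    (hker : ∀ u ∈ ball (0 : E) R, decKernel T dec (fun _ => 1) u =
      (withOp L₀ fun b u => Hd h b * extend (compress (1 + K' u) (Es b))⁻¹ * Hd h b).kernel (fun _ => 1) u *
        ((1 : Matrix n n ℂ) + (-1 : ℂ) •
          (withOp L₀ fun b u =>
            (Hd h b * K' u - K' u * Hd h b) * extend (compress (1 + K' u) (Es b))⁻¹ * Hd h b).kernel (fun _ => 1) u)⁻¹)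
    (hsum : ∀ y, ∑ b, h b y ^ 2 = 1) (hsupp : ∀ b y, y ∉ Es b → h b y = 0) (hm : 0 < m)
    (hcoer : ∀ u ∈ ball (0 : E) R, ∀ j, ∀ z : n → ℂ, m * nsq z ≤ (conjForm (1 + K' u) κc (fun e => ds e j) z).re)
    (hunit : ∀ u ∈ ball (0 : E) R, IsUnit
      (1 - (withOp L₀ fun b u =>
        (Hd h b * K' u - K' u * Hd h b) * extend (compress (1 + K' u) (Es b))⁻¹ * Hd h b).kernel (fun _ => (1 : ℂ)) u).det) :
    ∀ u ∈ ball (0 : E) R, decKernel T dec (fun _ => 1) u = (1 + K' u)⁻¹ :=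
  decKernel_one_eq_inv (L := withOp L₀ fun b u => extend (compress (1 + K' u) (Es b))⁻¹) hker hsum hsupp
    (fun b u hu => (locInv_letters (L₀ := L₀) (R := R) u hu hm hcoer b).1)
    (fun b u hu => (locInv_letters (L₀ := L₀) (R := R) u hu hm hcoer b).2) hunit

end End

end Summit.QuantumFields.BalabanUV.Gaps.D4WalkBlockAccretiveDecay

end
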